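import Summits.ResolutionOfSingularities.ResolutionOfSingularities.Theorems.EquisingularLiftEquisingularLiftNatMemberKCLStepSingular
import Summits.ResolutionOfSingularities.ResolutionOfSingularities.Theorems.EquisingularLiftEquisingularLiftNatCarrierExactPointSteps
import Summits.ResolutionOfSingularities.ResolutionOfSingularities.Theorems.EquisingularLiftEquisingularLiftNatStrictTransformFlat
import Summits.ResolutionOfSingularities.ResolutionOfSingularities.Theorems.EquisingularLiftEquisingularLiftNatSubchainSupplierInvSZeroLDefs
import HarnessLib

/-!
# [OURS · L1 W4.5(b) · EL♮(3) · T23-A‴ (U6), SHADOW-FREE ARM] (C)S₀ AT AN EXPLICIT STAGE WITH EXPLICIT OUTPUTS: `memberS₀At_strictTransform_of_centredPoint`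
# — res-type-027's R2 `memberS₀_strictTransform_of_centredPoint` (…NatMemberSZeroStepSingular p620701) restated on `TCPlus.MemberS₀At`
# (…NatSubchainSupplierInvSZeroLDefs) and RETURNING the package section `s`, the blow-up `τ`, the model square `(j₂, t₂)` and the `{j x}`-fibre fact
# (the twin of …NatMemberSAtStepSingular p627303 in the shadow-free arm)

res-type-027 g18 ((U6) owner), brick (G3). OURS; NOT a statement of any manuscript ([Hironaka2017] is a candidate under adjudication, nothing of it is
asserted); AI-written, weaker than expert review. No `sorry`; standard axioms; DEF-FREE; `--supports stmt-ResolutionOfSingularities-20148 --as helper`.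
PROOF = p620701's VERBATIM (credit for the (C) engine: res-L1-w45b-stub-4 / -stub-1, K3″ res-D-pv-029), the final anonymous constructor opened up.
[cite: GortzWedhorn2020, Prop. 13.91 and (13.19)] [cite: Liu2002, Thm. 8.1.19] [cite: Matsumura1987, Thm. 14.2] [cite: StacksProject, Tag 01WS]
-/

set_option linter.dupNamespace false -- mandated namespace `Summit.<Summit>.<Problem>` of this single-conjunct summit
set_option linter.overlappingInstances false -- signatures carry `[IsDomain O] [IsDiscreteValuationRing O]`

noncomputable section

open CategoryTheory CategoryTheory.Limits AlgebraicGeometry TopologicalSpace Topology IsLocalRing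
open Literature.AlgebraicGeometry.Resolution
open AlgebraicGeometry.Scheme.IdealSheafData
open Summit.ResolutionOfSingularities.ResolutionOfSingularities.Theses.EquisingularLift.Split
open Summit.ResolutionOfSingularities.ResolutionOfSingularities.Cruxes.EquisingularLift.StrataSplit
open scoped nonZeroDivisors

namespace Summit.ResolutionOfSingularities.ResolutionOfSingularities.Cruxes.EquisingularLiftNat.Sections

/-- **(C)S₀ at an explicit stage, explicit outputs** (see the module docstring). [cite: Matsumura1987, Thm. 14.2 and Thm. 20.3]
[cite: GortzWedhorn2020, Prop. 13.91 and Prop. 13.96] [cite: Liu2002, Thm. 8.1.19] [cite: StacksProject, Tag 01WS] [OURS · L1 W4.5b · T23-A‴ (U6)] brick (G3)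
(stmt-ResolutionOfSingularities-20148); NOT a statement of the manuscript. -/
theorem memberS₀At_strictTransform_of_centredPoint (O : Type) [CommRing O] [IsDomain O] [IsDiscreteValuationRing O]
    (k : Type) [Field k] (θ : O →+* k) (hθ : Function.Surjective θ)
    (P : Scheme.{0}) [IsIntegral P] (q : P ⟶ Spec (.of O)) [IsProper q] [SmoothOfRelativeDimension 3 q]
    (Y : Set P) (hYsp : Y ⊆ q ⁻¹' {closedPoint O}) (hYirr : IsIrreducible Y) (hYcl : IsClosed Y)
    (hPnoeth : IsLocallyNoetherian P) (hPreg : Scheme.IsRegular P)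
    (Ch : ∀ X' : Scheme.{0}, (X' ⟶ P) → Set X' → Prop)
    (hChain : ∀ (X' : Scheme.{0}) (σ : X' ⟶ P) (S : Set X'), Ch X' σ S → Chain P Y X' σ S)
    (hStep : ∀ (X' X'' : Scheme.{0}) (σ' : X' ⟶ P) (S' : Set X') (C : X'.IdealSheafData) (τ : X'' ⟶ X'),
      Ch X' σ' S' → IsBlowup τ C → Scheme.IsRegular C.subscheme → Flat (C.subschemeι ≫ σ' ≫ q) →
      σ' '' (C.support : Set X') ⊆ {x : P | ¬ IsGenericPoint x Y} →
      (C.support : Set X') ∩ (σ' ≫ q) ⁻¹' {closedPoint O} ⊆ S' →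
      Ch X'' (τ ≫ σ') (closure (τ ⁻¹' (S' \ (C.support : Set X')))))
    (G : Scheme.{0}) [IsIntegral G] (T Z Sd : Set G) (x : G) (hx : IsClosed ({x} : Set G)) (hxT : x ∈ T) (hTx : ¬ T ⊆ {x})
    (X : Scheme.{0}) (σ : X ⟶ P) (S : Set X) (j : G ⟶ X) (t : G ⟶ Spec (.of k)) (𝓢 K : X.IdealSheafData)
    (hmem : TCPlus.MemberS₀At O k θ P q Y Ch G T Z Sd {x} X σ S j t 𝓢 K)
    (G₂ : Scheme.{0}) (υ : G₂ ⟶ G) (hυ : IsBlowup υ (vanishingIdeal ⟨{x}, hx⟩)) :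
    ∃ (s : Spec (.of O) ⟶ X) (X₂ : Scheme.{0}) (τ : X₂ ⟶ X) (j₂ : G₂ ⟶ X₂) (t₂ : G₂ ⟶ Spec (.of k)),
      s ≫ σ ≫ q = 𝟙 _ ∧ s (closedPoint O) = j x ∧ IsBlowup τ s.ker ∧ j₂ ≫ τ = υ ≫ j ∧
      (s.ker.support : Set X) ∩ (σ ≫ q) ⁻¹' {closedPoint O} = {j x} ∧
      IsIntegral G₂ ∧ IsIrreducible (closure (υ ⁻¹' (T \ {x}))) ∧
      TCPlus.MemberS₀At O k θ P q Y Ch G₂ (closure (υ ⁻¹' (T \ {x}))) (closure (υ ⁻¹' (Z \ {x})))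
        (closure (υ ⁻¹' (Sd \ {x}))) ∅ X₂ (τ ≫ σ)
        (closure (τ ⁻¹' (S \ (s.ker.support : Set X)))) j₂ t₂ (strictTransformIdeal τ s.ker 𝓢) (strictTransformIdeal τ s.ker K) := by
  classical
  obtain ⟨hCh, hXint, hXnoeth, hXreg, hdom, hsq, hTS, hi, hii, hiii₁, hiii₂, hiv, hv, hvi, hviii, hix, hSflat⟩ := hmem
  haveI := hXint
  haveI := hXnoeth
  obtain ⟨s, hs, hsx, hle, c, m, Φ, hcJ, hc, hdomc, hcb, h𝓢, -, hΦm, hK, hΦc, hΦ𝔪, hΔ⟩ := hvi x (Set.mem_singleton x)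
  haveI := hdomc
  -- the stage is proper over `Spec O`
  obtain ⟨-, -, hσ⟩ := chain_isRegular P Y X σ S (hChain _ _ _ hCh) hPnoeth hPreg
  haveI := hσ
  haveI : IsProper (σ ≫ q) := inferInstance
  -- the model square: `j` is a closed immersion onto the special fibre
  haveI : IsClosedImmersion (Spec.map (CommRingCat.ofHom θ)) := IsClosedImmersion.spec_of_surjective _ hθ
  haveI hjci : IsClosedImmersion j := MorphismProperty.IsStableUnderBaseChange.of_isPullback hsq.flip inferInstance
  haveI : IsLocallyNoetherian G := LocallyOfFiniteType.isLocallyNoetherian j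
  have hrangej : Set.range j = (σ ≫ q) ⁻¹' {closedPoint O} := by
    rw [range_eq_preimage_of_isPullback hsq, range_specMap_of_surjective_of_field θ hθ]
  have hjxsp : (σ ≫ q) (j x) = closedPoint O := by
    have h : j x ∈ Set.range j := ⟨x, rfl⟩
    rw [hrangej] at h
    exact h
  have hjxcl : IsClosed ({j x} : Set X) := by
    rw [← Set.image_singleton]; exact hjci.isClosedEmbedding.isClosedMap _ hx
  have hrs : ∀ p' : Spec (.of O), (σ ≫ q) (s p') = p' := fun p' => by
    rw [← Scheme.Hom.comp_apply, hs]; rfl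
  -- the centre `ker s` and the stepped point `j x = s(𝔪_O)`
  obtain ⟨_, -, -, hCsupp⟩ := section_isClosedImmersion_and_isRegular_ker O X (σ ≫ q) s hs
  have hpC : j x ∈ (s.ker.support : Set X) := by rw [hCsupp, ← hsx]; exact ⟨_, rfl⟩
  have hpD : j x ∈ ((𝓢 ⊔ K).support : Set X) := Scheme.IdealSheafData.support_antitone hle hpC
  have hw : ¬ IsGenericPoint (σ (j x)) Y := hiv ⟨j x, hpD, rfl⟩
  -- blow the section up; the model point step (res-D-pv-029, K3″)
  obtain ⟨X₂, τ, hτ⟩ := exists_isBlowup X s.ker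
  obtain ⟨hCh₂, hreg₂, hnoeth₂, hint₂, hdom₂, hG₂int, hT₂irr, hJ, -, -, -, j₂, t₂, hsq₂, hcomm, -, hsets⟩ :=
    modelPointStep_of_section O k θ hθ P q Y hYsp hYirr hYcl Ch hChain hStep X σ S hCh hXreg hdom G j t hsq T hTS x hx hxT
      hTx hw s hs hsx X₂ τ hτ G₂ υ hυ
  haveI := hnoeth₂
  haveI := hG₂int
  haveI hj₂ci : IsClosedImmersion j₂ := MorphismProperty.IsStableUnderBaseChange.of_isPullback hsq₂.flip inferInstance
  haveI : IsLocallyNoetherian G₂ := LocallyOfFiniteType.isLocallyNoetherian j₂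
  -- a uniformizer; the section-frame identities hold for the package frame (same ideal `(ker s)_{j x}`)
  obtain ⟨ϖ, hϖ⟩ := IsDiscreteValuationRing.exists_irreducible O
  obtain ⟨n', c', -, hc'J, -, -, -, h𝔪', hϖc', -⟩ :=
    exists_sectionFrame_forall_dim_at O (σ ≫ q) s hs (j x) hsx (hXreg (j x)) ϖ hϖ
  have h𝔪 : Ideal.span (Set.range c) ⊔
      Ideal.span {(X.presheaf.Γgerm (j x)).hom ((σ ≫ q).appTop.hom ((Scheme.ΓSpecIso (.of O)).inv.hom ϖ))} =
        maximalIdeal (X.presheaf.stalk (j x)) := by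
    rw [hcJ, ← hc'J]; exact h𝔪'
  have hϖc : (X.presheaf.Γgerm (j x)).hom ((σ ≫ q).appTop.hom ((Scheme.ΓSpecIso (.of O)).inv.hom ϖ)) ∉
      Ideal.span (Set.range c) := by
    rw [hcJ, ← hc'J]; exact hϖc'
  -- `dim 𝒪_{X, j x} = 3 + 1` (T-DIM)
  have hdim : ringKrullDim (X.presheaf.stalk (j x)) = (2 + 2 : ℕ) :=
    ringKrullDim_stalk_eq_succ_of_chain q 3 (hYirr.isGenericPoint_genericPoint hYcl) (hChain _ _ _ hCh) hjxcl hjxsp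
  -- supports: `supp (St 𝓢 ⊔ St K) ⊆ τ⁻¹ supp (𝓢 ⊔ K)`
  have hStsub : ∀ I : X.IdealSheafData,
      ((strictTransformIdeal τ s.ker I).support : Set X₂) ⊆ τ ⁻¹' (I.support : Set X) := fun I =>
    (support_strictTransformIdeal_subset τ s.ker I).trans
      (closure_minimal (Set.preimage_mono fun _ h => h.1) (I.support.isClosed.preimage τ.continuous))
  have hsuppτ : ∀ z ∈ ((strictTransformIdeal τ s.ker 𝓢 ⊔ strictTransformIdeal τ s.ker K).support : Set X₂),
      τ z ∈ ((𝓢 ⊔ K).support : Set X) := by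
    intro z hz
    have h1 : τ z ∈ (𝓢.support : Set X) := hStsub 𝓢 (Scheme.IdealSheafData.support_antitone le_sup_left hz)
    have h2 : τ z ∈ (K.support : Set X) := hStsub K (Scheme.IdealSheafData.support_antitone le_sup_right hz)
    rw [Scheme.IdealSheafData.support_sup, Closeds.coe_inf]
    exact ⟨h1, h2⟩
  -- (iii) regular carrier, locally principal pair: K7d (the carrier is non-zero: `c₀ ≠ 0` by quasi-regularity)
  have hItop : Ideal.span (Set.range c) ≠ ⊤ := fun h =>
    not_subsingleton (X.presheaf.stalk (j x) ⧸ Ideal.span (Set.range c)) (Ideal.Quotient.subsingleton_iff.mpr h)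
  have hc0 : c 0 ≠ 0 := by
    intro h0
    have hmem := (isQuasiRegular_def c).mp hc 1 (MvPolynomial.X 0) (MvPolynomial.isHomogeneous_X _ 0)
      (by rw [MvPolynomial.eval_X, h0]; exact Ideal.zero_mem _) (Finsupp.single 0 1)
    simp only [MvPolynomial.coeff_X, if_true] at hmem
    exact hItop ((Ideal.eq_top_iff_one _).mpr hmem)
  have h𝓢0 : 𝓢 ≠ ⊥ := by
    intro h
    apply hc0
    have h' : stalkIdeal 𝓢 (j x) = ⊥ := by rw [h]; exact stalkIdeal_bot _
    rw [h𝓢, Ideal.span_singleton_eq_bot] at h'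
    exact h'
  obtain ⟨⟨hiii₁', hiii₂'⟩, -⟩ :=
    member_clause_iii_strictTransform_section O (σ ≫ q) s hs hXreg hτ 𝓢 K hle h𝓢0 ⟨hiii₁, hiii₂⟩
  have hv₂ : ∀ z ∈ ((strictTransformIdeal τ s.ker 𝓢 ⊔ strictTransformIdeal τ s.ker K).support : Set X₂),
      ((τ ≫ σ) ≫ q) z = closedPoint O → z ∉ j₂ '' (∅ : Set G₂) →
      IsRegularLocalRing (X₂.presheaf.stalk z ⧸ stalkIdeal (strictTransformIdeal τ s.ker 𝓢 ⊔ strictTransformIdeal τ s.ker K) z) ∧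
      (IsClosed ({z} : Set X₂) →
        ringKrullDim (X₂.presheaf.stalk z ⧸ stalkIdeal (strictTransformIdeal τ s.ker 𝓢 ⊔ strictTransformIdeal τ s.ker K) z) + 2 =
          ringKrullDim (X₂.presheaf.stalk z)) := by
    intro z hz hzs _
    have hzs' : (σ ≫ q) (τ z) = closedPoint O := by simpa only [Scheme.Hom.comp_apply] using hzs
    by_cases hzp : τ z = j x
    · -- over the stepped point: the Δ-package
      have key := isRegularLocalRing_quotient_carrierStrictTransform_of_coneDeltaRegular_at hτ 𝓢 K (j x) z hzp hpC c hcJ hc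
        hcb h𝓢 Φ hΦm hΦc hK hz hΔ
      exact ⟨key.1, fun _ => key.2⟩
    · -- off the stepped point: `τ` is an isomorphism there and the old member's clause (v) applies
      have hzC : τ z ∉ (s.ker.support : Set X) := by
        rw [hCsupp]
        rintro ⟨p', hp'⟩
        have hp's : p' = closedPoint O := by rw [← hrs p', hp']; exact hzs'
        exact hzp (by rw [← hp', hp's, hsx])
      have hτz : τ z ∉ j '' {x} := by rw [Set.image_singleton]; exact hzp
      obtain ⟨hreg₀, hcod₀⟩ := hv (τ z) (hsuppτ z hz) hzs' hτz
      obtain ⟨hreg₁, hdim₁⟩ := isRegularLocalRing_quotient_carrierStrictTransform_of_not_mem_support hτ 𝓢 K hzC hreg₀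
      refine ⟨hreg₁, fun hzcl => ?_⟩
      haveI : IsProper τ := hτ.isProper
      have hτzcl : IsClosed ({τ z} : Set X) := by rw [← Set.image_singleton]; exact τ.isClosedMap _ hzcl
      rw [hdim₁, ringKrullDim_stalk_eq_of_not_mem_support hτ hzC]
      exact hcod₀ hτzcl
  -- the `{j x}`-fibre fact of the section centre (for the planes' AWAY transports in the same stage)
  have hCb : (s.ker.support : Set X) ∩ (σ ≫ q) ⁻¹' {closedPoint O} = {j x} := by
    ext z
    constructor
    · rintro ⟨hz, hzsp⟩
      rw [hCsupp] at hz
      obtain ⟨p, rfl⟩ := hz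
      have hp : p = closedPoint O := by rw [← hrs p]; exact hzsp
      rw [Set.mem_singleton_iff, hp, hsx]
    · rintro rfl
      exact ⟨hpC, hjxsp⟩
  refine ⟨s, X₂, τ, j₂, t₂, hs, hsx, hτ, hcomm, hCb, hG₂int, hT₂irr, hCh₂, hint₂, hnoeth₂, hreg₂, hdom₂, hsq₂, hsets,
    ?_, ?_, hiii₁', hiii₂', ?_, ?_, ?_, ?_, ?_, flat_strictTransform_subschemeι_comp_stage O σ q τ s.ker hτ 𝓢 hSflat⟩
  · -- (i) exact special fibre: F⁺5 for the cone pack, then K7e downstairs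
    rw [comap_strictTransformIdeal_carrierPair_eq_sup_of_conePack O k θ hθ (σ ≫ q) j t hsq s.ker τ hτ υ j₂ hcomm x hx hυ hJ
        ϖ hϖ c hcJ hc hcb hϖc h𝔪 𝓢 K h𝓢 Φ hΦm hK hΦc hΦ𝔪,
      strictTransformIdeal_comap_sup_eq_vanishingIdeal_of_centredPackage O k θ hθ (σ ≫ q) j t hsq x hx υ hυ ϖ hϖ c hc hcb
        hϖc h𝔪 𝓢 K h𝓢 Φ hΦm hK hΦ𝔪 Z hi]
    congr 1
    exact Closeds.ext closure_closure.symm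
  · -- (ii) flat over `O`: K7b with the package frame
    exact flat_carrierStrictTransform_subschemeι_comp_at O σ q s hs τ hτ 𝓢 K hii (j x) hsx c hcJ h𝓢 Φ hΦm hK ϖ hϖ h𝔪
      hdim hΦ𝔪
  · -- (iv) off the generic point of `Y`
    rintro _ ⟨z, hz, rfl⟩
    rw [Scheme.Hom.comp_apply]
    exact hiv ⟨τ z, hsuppτ z hz, rfl⟩
  · exact hv₂
  · -- (vi) no excluded point
    simp
  · -- (viii) the carrier still cuts an effective Cartier divisor on the cone (pointwise Cartier datum at the closed points)
    haveI : IsProper τ := hτ.isProper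
    haveI : CompactSpace ↥X₂ := by
      haveI : IsProper ((τ ≫ σ) ≫ q) := by rw [Category.assoc]; infer_instance
      exact QuasiCompact.compactSpace_of_compactSpace ((τ ≫ σ) ≫ q)
    refine isEffectiveCartier_comap_subschemeι_of_forall_isClosed _ _ fun z hzc hzK hz𝓢 => ?_
    have hsp : ((τ ≫ σ) ≫ q) z = closedPoint O :=
      eq_closedPoint_of_isClosed_singleton (by simpa only [Set.image_singleton] using ((τ ≫ σ) ≫ q).isClosedMap _ hzc)
    obtain ⟨f₁, hf₁⟩ := (hiii₂' z).2
    obtain ⟨h₁, hh₁⟩ := (hiii₂' z).1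
    change stalkIdeal (strictTransformIdeal τ s.ker K) z = Ideal.span {f₁} at hf₁
    change stalkIdeal (strictTransformIdeal τ s.ker 𝓢) z = Ideal.span {h₁} at hh₁
    by_cases hzc₀ : τ z ∈ (s.ker.support : Set X)
    · -- over the centre: codimension two by clause (v) of the new member (no excluded point)
      have hzsupp : z ∈ ((strictTransformIdeal τ s.ker 𝓢 ⊔ strictTransformIdeal τ s.ker K).support : Set X₂) :=
        mem_support_sup_of_mem _ _ hz𝓢 hzK
      obtain ⟨-, hcod⟩ := hv₂ z hzsupp hsp (by simp)
      have hdim₂ := hcod hzc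
      rw [stalkIdeal_sup, hh₁, hf₁] at hdim₂
      have hR : ringKrullDim (X₂.presheaf.stalk z) = ((2 + 2 : ℕ) : WithBot ℕ∞) :=
        ringKrullDim_stalk_eq_succ_of_chain q 3 (hYirr.isGenericPoint_genericPoint hYcl) (hChain _ _ _ hCh₂) hzc (by
          simpa only [Scheme.Hom.comp_base, TopCat.coe_comp, Function.comp_apply] using hsp)
      haveI := hreg₂ z
      exact ⟨f₁, h₁, hf₁, hh₁, cartierDatum_of_codimTwo hR hdim₂⟩
    · -- off the centre: transport the old datum along `τ`
      have hτzK : τ z ∈ (K.support : Set X) := hStsub K hzK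
      obtain ⟨w₀, hw₀⟩ : ∃ w₀ : ↥K.subscheme, K.subschemeι w₀ = τ z := by
        rw [← Set.mem_range, Scheme.IdealSheafData.range_subschemeι]; exact hτzK
      obtain ⟨f₀, hf₀⟩ := (hiii₂ (τ z)).2
      obtain ⟨h₀, hh₀⟩ := (hiii₂ (τ z)).1
      change stalkIdeal K (τ z) = Ideal.span {f₀} at hf₀
      change stalkIdeal 𝓢 (τ z) = Ideal.span {h₀} at hh₀
      have hd₀ := datum_of_mem_cartierLocus_subschemeι 𝓢 K w₀ hw₀ (hviii.mem_cartierLocus w₀) f₀ h₀ hf₀ hh₀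
      obtain ⟨hK', h𝓢', hnzd'⟩ := datum_strictTransform_of_not_mem_support hτ 𝓢 K hzc₀ f₀ h₀ hf₀ hh₀ hd₀
      exact ⟨_, _, hK', h𝓢', hnzd'⟩
  · -- (ix) THE PLANE TRACE steps as the reduced strict transform of the closed plane: carrier-alone exactness in frame form
    -- (res-type-027 `comap_strictTransformIdeal_carrier_eq_of_frame`, the package frame has `𝓢_p = (c₀)`), then
    -- `St_υ 𝓘⟨closure S_d⟩ = 𝓘⟨closure υ⁻¹(closure S_d ∖ {x})⟩`
    rw [comap_strictTransformIdeal_carrier_eq_of_frame O k θ hθ (σ ≫ q) j t hsq s.ker τ hτ υ j₂ hcomm x hx hυ hJ ϖ hϖ c hcJ hc hϖc h𝔪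
        𝓢 h𝓢, hix, strictTransformIdeal_vanishingIdeal_eq υ _ hυ]
    congr 1
    apply Closeds.ext
    change closure (υ ⁻¹' (closure Sd \ ((vanishingIdeal (⟨{x}, hx⟩ : Closeds G)).support : Set G))) =
      closure (closure (υ ⁻¹' (Sd \ {x})))
    rw [Scheme.IdealSheafData.coe_support_vanishingIdeal, closure_closure]
    exact closure_preimage_closure_diff_singleton hx hυ Sd

end Summit.ResolutionOfSingularities.ResolutionOfSingularities.Cruxes.EquisingularLiftNat.Sections

end
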